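import Literature.NumberTheory.Rogawski1990.ArchHcJumpTwoChart                    -- ★ p851048 (F0P3a-p08 (g23)) (B-trans): `hasOneSidedJump_iteratedFDeriv_adaptedWord_of_twoChart` (GIVEN-form, abstract readers `Φ₁ Φ₂`, class `Adm`, derivative `D`)
import Literature.NumberTheory.Automorphic.ArchRankOneOrbitalFamilyParamCayley       -- ★ p851143 (this seat) (B-par) on `U(J)`: `contDiffOn_cayley_orbitalIntegral_param`, `fderiv_cayley_orbitalIntegral_param_prod_apply`, `fderiv_splitIntegral_param_prod_apply`; brings ★ p851042 (`contDiff_splitIntegral_param`) and ★ p851003 (`contDiff_uncurry_fderiv_apply`, `forall_fderiv_apply_eq_zero_of_support`)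
import HarnessLib

/-!
# (I₃) ADAPTED WORDS, THE READERS PLUGGED: ★ p851048's two-chart word theorem with `Φ₁ :=` the `U(J)`-Cayley normalised elliptic orbital integral and `Φ₂ :=` the split
# half-chart integral of a SMOOTH FAMILY — its five analytic sockets `Adm ∕ D ∕ hcl ∕ h1 ∕ h2` discharged by (B-par) (Harish-Chandra; Varadarajan 1977 I §1.12; Shelstad 1979 §4)

Topic `NumberTheory/Rogawski1990`; namespace `Literature.NumberTheory.Rogawski1990`.  THEOREMS ONLY (no `def`, no instance, no notation, no axiom, no named fact, no `sorry`);
kernel lane `--kind proof --supports stmt-HodgeConjecture-24833`.  Cell `pub/hodgecm-mathlib`, crux H413 (`stmt-HodgeConjecture-24833`), F0∕P3c line LH3 (closer stub `stub_N9`,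
leaf `F0_P3c_StubN9Direct`, letter L1 clause (I₃) `ArchHcJump`), SPEC-I3 v1.1 — the JUNCTION of brick (B-trans) ★ p851048 (F0P3a-p08 (g23)) with brick (B-par) ★ p851003 ∕ p851042 ∕
p851143 (F0P3a-p04 (g24)); consumer: (B-jc) `ArchOrbFamGExtJumpWall02` (F0P3a-p08), which now owes ONLY the two descent identities `hdesc₁`, `hdesc₂`, the 1-D Wick input and the
rank-one junction `hjump` at the base parameter.

THE STATEMENT (`hasOneSidedJump_iteratedFDeriv_adaptedWord_of_twoChart_orbital`).  ★ p851048 VERBATIM, with its abstract data SPECIALISED: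
* `Y → V := Matrix (Fin 2) (Fin 2) ℂ → ℂ` (test functions), `Adm g :≡ ContDiff ℝ ∞ (uncurry g) ∧ ∃ C, IsCompact C ∧ ∀ q X, X ∉ C → g q X = 0` (SPEC-I3 §2 family class),
  `D v g :≡ fun q X => fderiv ℝ (fun q′ => g q′ X) q v` (the transversal parameter derivative) — so `hcl` is ★ p851003 `contDiff_uncurry_fderiv_apply` +
  `forall_fderiv_apply_eq_zero_of_support`;
* `Φ₁ := F`, the normalised elliptic orbital integral on the SHARED-DATUM carrier `U(J)`, `hJ : J = (StdForm.antidiagonal 2).over ℂ`, CAYLEY torus `P · diag(z e^{iψ}, z e^{−iψ}) · P⁻¹`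
  (binder `hΦ₁` = ★ p851143's `hF` text at `E := ℂ`; any centre `z`, any `μ` finite on compacts) — so `h1₁` is ★ `contDiffOn_cayley_orbitalIntegral_param` restricted to
  `Q ×ˢ T₁` (`T₁ ⊆ {sin ψ ≠ 0}`, hypothesis `hT₁s`) and `h2₁` is ★ `fderiv_cayley_orbitalIntegral_param_prod_apply`;
* `Φ₂ := Λ`, the split half-chart integral on the same `U(J)` (binder `hΦ₂` = ★ p851042's `hΛ` text at `E := ℂ`; `K` compact, `κK`, `μN` Haar, angle `θ`) — so `h1₂` is ★
  `contDiff_splitIntegral_param` and `h2₂` is ★ `fderiv_splitIntegral_param_prod_apply`;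
and the remaining GIVEN inputs (`g` admissible, cofactor data `Pf Ef ce ch hwick K₁ K₂ κ`, the wall point, `hdesc₁`, `hdesc₂`, `hjump`) exactly as in ★ p851048.
HONEST LABEL: a junction by `exact`; count-neutral; HC_CM is proved only modulo the 7 printed citations (2 remaining: hLiu418 = stmt-HodgeConjecture-24832, h413 =
stmt-HodgeConjecture-24833) until rung 0 closes.

## References
* [Varadarajan1977] V. S. Varadarajan, *Harmonic Analysis on Real Reductive Groups*, LNM 576 (1977), Part I §1.12.
* [Shelstad1979] D. Shelstad, *Characters and inner forms of a quasi-split group over ℝ*, Compositio Math. 39 (1979), Lemma 4.3 p. 25, Prop. 4.5 p. 26.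
* [Bouaziz1994IntegralesOrbitales] A. Bouaziz, *Intégrales orbitales sur les groupes de Lie réductifs*, Ann. Sci. ÉNS 27 (1994), §3.2 (I₃) p. 580.
* [HormanderALPDO1] L. Hörmander, *The Analysis of Linear Partial Differential Operators I*, 2nd ed. (1990), §1.1 Thm. 1.1.8–1.1.9.
-/

set_option autoImplicit false

noncomputable section

open Set Filter Function Complex MeasureTheory
open scoped Topology ContDiff MatrixGroups Matrix.Norms.Operator
open Literature.NumberTheory.Automorphic Literature.NumberTheory.Automorphic.UnitaryGroup
open Literature.NumberTheory.Automorphic.Shelstad1979.StableOrbitalIntegrals Literature.Analysis.Calculus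

namespace Literature.NumberTheory.Rogawski1990

variable {W : Type*} [Fintype W] [DecidableEq W]

/-- **(I₃) FOR ADAPTED WORDS — ★ p851048 WITH THE (B-par) READERS PLUGGED.**  `Φ₁` = the `U(J)`-Cayley normalised elliptic orbital integral (`hΦ₁`), `Φ₂` = the split half-chart
integral (`hΦ₂`), the admissible class = «jointly `C^∞`, one compact support», `D v` = the transversal parameter derivative; the sockets `hcl ∕ h1₁ ∕ h2₁ ∕ h1₂ ∕ h2₂` of ★ p851048 are
★ p851003 ∕ ★ p851143 ∕ ★ p851042.  GIVEN an admissible family `g`, the cofactor data with the Wick input, the two descent identities near the wall point `p` and the rank-one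
junction `hjump` for admissible families at `p`, EVERY adapted-word jet of `F₁` along the normal ray jumps by `(K₁∕K₂)·κ · hcCayScalar w i m ·` the Cayley-word jet of `F₂`.
[cite: Varadarajan1977, I §1.12] [cite: Shelstad1979, Lemma 4.3 (p. 25), Prop. 4.5 (p. 26)] [cite: Bouaziz1994IntegralesOrbitales, §3.2 (I₃) p. 580] -/
theorem hasOneSidedJump_iteratedFDeriv_adaptedWord_of_twoChart_orbital (w : W) {i j : Fin 3} (hij : i ≠ j)
    {J : Matrix (Fin 2) (Fin 2) ℂ} (hJ : J = (StdForm.antidiagonal 2).over ℂ)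
    [MeasurableSpace ↥(unitaryGroupOfForm (starRingEnd ℂ) J)] [BorelSpace ↥(unitaryGroupOfForm (starRingEnd ℂ) J)]
    (μ : Measure ↥(unitaryGroupOfForm (starRingEnd ℂ) J)) [IsFiniteMeasureOnCompacts μ] (z : Circle)
    (Φ₁ : (Matrix (Fin 2) (Fin 2) ℂ → ℂ) → ℝ → ℂ)
    (hΦ₁ : ∀ (f : Matrix (Fin 2) (Fin 2) ℂ → ℂ) (ψ : ℝ), Φ₁ f ψ = (2 * Real.sin ψ) •
      ∫ h : ↥(unitaryGroupOfForm (starRingEnd ℂ) J),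
        f (((h * ⟨Matrix.GeneralLinearGroup.mkOfDetNeZero !![(1 : ℂ), 1; 1, -1] det_cayleyTwo_ne_zero *
              circleDiagonal 2 ![z * Circle.exp ψ, z * Circle.exp (-ψ)] * (Matrix.GeneralLinearGroup.mkOfDetNeZero !![(1 : ℂ), 1; 1, -1] det_cayleyTwo_ne_zero)⁻¹,
            cayley_conj_circleDiagonal_mem_of_eq_over hJ _⟩ * h⁻¹ : ↥(unitaryGroupOfForm (starRingEnd ℂ) J)) : GL (Fin 2) ℂ) : Matrix (Fin 2) (Fin 2) ℂ) ∂μ)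
    {K : Subgroup ↥(unitaryGroupOfForm (starRingEnd ℂ) J)} (κK : Measure ↥K) (μN : Measure ↥(unipotentU (starRingEnd ℂ) J))
    (hK : IsCompact (K : Set ↥(unitaryGroupOfForm (starRingEnd ℂ) J))) [κK.IsHaarMeasure] [μN.IsHaarMeasure] (θ : ℝ)
    (Φ₂ : (Matrix (Fin 2) (Fin 2) ℂ → ℂ) → ℝ → ℂ)
    (hΦ₂ : ∀ (f : Matrix (Fin 2) (Fin 2) ℂ → ℂ) (x : ℝ), Φ₂ f x = ∫ p : ↥K × ↥(unipotentU (starRingEnd ℂ) J), f ((((((p.1 : ↥K) : ↥(unitaryGroupOfForm (starRingEnd ℂ) J)) * (((⟨hypBlockGL 0 θ, hypBlockGL_mem_of_eq_over hJ 0 θ⟩ : ↥(unitaryGroupOfForm (starRingEnd ℂ) J))) * ((⟨hypBlockGL (x / 2) 0, hypBlockGL_mem_of_eq_over hJ (x / 2) 0⟩ : ↥(unitaryGroupOfForm (starRingEnd ℂ) J))) * ((p.2 : ↥(unipotentU (starRingEnd ℂ) J)) : ↥(unitaryGroupOfForm (starRingEnd ℂ) J)) * ((⟨hypBlockGL (x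 / 2) 0, hypBlockGL_mem_of_eq_over hJ (x / 2) 0⟩ : ↥(unitaryGroupOfForm (starRingEnd ℂ) J)))) * ((p.1 : ↥K) : ↥(unitaryGroupOfForm (starRingEnd ℂ) J))⁻¹ : ↥(unitaryGroupOfForm (starRingEnd ℂ) J))) : GL (Fin 2) ℂ) : Matrix (Fin 2) (Fin 2) ℂ) ∂(κK.prod μN))
    {T₁ : Set ℝ} (hT₁ : IsOpen T₁) (hT₁s : T₁ ⊆ {ψ : ℝ | Real.sin ψ ≠ 0}) (hray : ∀ᶠ t : ℝ in 𝓝[≠] 0, t ∈ T₁)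
    {Q : Set (W → Fin 3 → ℝ)} (hQ : IsOpen Q)
    (g : (W → Fin 3 → ℝ) → Matrix (Fin 2) (Fin 2) ℂ → ℂ) (hg : ContDiff ℝ ∞ (Function.uncurry g))
    (hgc : ∃ C : Set (Matrix (Fin 2) (Fin 2) ℂ), IsCompact C ∧ ∀ (q : W → Fin 3 → ℝ) (X : Matrix (Fin 2) (Fin 2) ℂ), X ∉ C → g q X = 0)
    (Pf Ef : (W → Fin 3 → ℝ) → ℂ) (hPf : ContDiffOn ℝ ∞ Pf Q) (hEf : ContDiffOn ℝ ∞ Ef Q)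
    (ce ch : ℝ → ℂ) (hce : ContDiff ℝ ∞ ce) (hch : ContDiff ℝ ∞ ch) (hwick : ∀ a : ℕ, iteratedDeriv a ce 0 = I ^ a * iteratedDeriv a ch 0)
    (K₁ K₂ κ : ℂ) (hK₂ : K₂ ≠ 0)
    {p : W → Fin 3 → ℝ} (hp : p w i = p w j) (hpQ : p ∈ Q)
    (F₁ F₂ : (W → Fin 3 → ℝ) → ℂ) {U₁ U₂ : Set (W → Fin 3 → ℝ)} (hU₁ : IsOpen U₁) (hpU₁ : p ∈ U₁) (hU₂ : IsOpen U₂) (hpU₂ : hcCayPt w i j p ∈ U₂)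
    (hdesc₁ : ∀ c ∈ U₁, (c w i - c w j) / 2 ∈ T₁ →
      F₁ c = K₁ * (ce ((c w i - c w j) / 2) * Pf (c - ((c w i - c w j) / 2) • hcNrm w i j) - Ef (c - ((c w i - c w j) / 2) • hcNrm w i j)) *
        Φ₁ (g (c - ((c w i - c w j) / 2) • hcNrm w i j)) ((c w i - c w j) / 2))
    (hdesc₂ : ∀ c ∈ U₂,
      F₂ c = K₂ * (ch (c w 0) * Pf (Function.update c w (fun s => if s = hcThird i j then c w 1 else c w 2)) -
          Ef (Function.update c w (fun s => if s = hcThird i j then c w 1 else c w 2))) *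
        Φ₂ (g (Function.update c w (fun s => if s = hcThird i j then c w 1 else c w 2))) (c w 0))
    (hjump : ∀ g' : (W → Fin 3 → ℝ) → Matrix (Fin 2) (Fin 2) ℂ → ℂ,
      (ContDiff ℝ ∞ (Function.uncurry g') ∧ ∃ C : Set (Matrix (Fin 2) (Fin 2) ℂ), IsCompact C ∧ ∀ (q : W → Fin 3 → ℝ) (X : Matrix (Fin 2) (Fin 2) ℂ), X ∉ C → g' q X = 0) →
      ∀ a : ℕ, HasOneSidedJump (fun t : ℝ => iteratedDeriv a (Φ₁ (g' p)) t) (κ * I ^ a * iteratedDeriv a (Φ₂ (g' p)) 0))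
    (n : ℕ) (m : Fin n → W × Fin 3) :
    HasOneSidedJump (fun ν : ℝ => iteratedFDeriv ℝ n F₁ (p + ν • hcNrm w i j) (fun r => hcAdaptedVec w i j (m r)))
      (K₁ / K₂ * κ * hcCayScalar w i m * iteratedFDeriv ℝ n F₂ (hcCayPt w i j p) (fun r => hcCayVec w i j (m r))) := by
  refine hasOneSidedJump_iteratedFDeriv_adaptedWord_of_twoChart w hij Φ₁ Φ₂ hT₁ hray
    (fun g' : (W → Fin 3 → ℝ) → Matrix (Fin 2) (Fin 2) ℂ → ℂ =>
      ContDiff ℝ ∞ (Function.uncurry g') ∧ ∃ C : Set (Matrix (Fin 2) (Fin 2) ℂ), IsCompact C ∧ ∀ (q : W → Fin 3 → ℝ) (X : Matrix (Fin 2) (Fin 2) ℂ), X ∉ C → g' q X = 0)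
    (fun (v : W → Fin 3 → ℝ) (g' : (W → Fin 3 → ℝ) → Matrix (Fin 2) (Fin 2) ℂ → ℂ) => fun q X => fderiv ℝ (fun q' : W → Fin 3 → ℝ => g' q' X) q v)
    ?_ hQ ?_ ?_ ?_ ?_ g ⟨hg, hgc⟩ Pf Ef hPf hEf ce ch hce hch hwick K₁ K₂ κ hK₂ hp hpQ F₁ F₂ hU₁ hpU₁ hU₂ hpU₂ hdesc₁ hdesc₂ hjump n m
  · -- `hcl`: the class is closed under `D v` (★ p851003)
    rintro g' ⟨hg', C, hC, h0⟩ v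
    exact ⟨contDiff_uncurry_fderiv_apply hg' v, C, hC, forall_fderiv_apply_eq_zero_of_support h0 v⟩
  · -- `h1₁`: joint smoothness of the elliptic reader on `Q ×ˢ T₁ ⊆ univ ×ˢ {sin ≠ 0}` (★ p851143)
    rintro g' ⟨hg', hgc'⟩
    exact (contDiffOn_cayley_orbitalIntegral_param hJ μ z Φ₁ hΦ₁ g' hg' hgc').mono (Set.prod_mono (Set.subset_univ _) hT₁s)
  · -- `h2₁`: the elliptic reader differentiates its family (★ p851143, joint form)
    rintro g' ⟨hg', hgc'⟩ v x hx
    exact fderiv_cayley_orbitalIntegral_param_prod_apply hJ μ z Φ₁ hΦ₁ g' hg' hgc' v (hT₁s (Set.mem_prod.1 hx).2)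
  · -- `h1₂`: joint smoothness of the split reader everywhere (★ p851042)
    rintro g' ⟨hg', hgc'⟩
    exact (contDiff_splitIntegral_param hJ κK μN hK θ Φ₂ hΦ₂ g' hg' hgc').contDiffOn
  · -- `h2₂`: the split reader differentiates its family (★ p851143, joint form)
    rintro g' ⟨hg', hgc'⟩ v x _
    exact fderiv_splitIntegral_param_prod_apply hJ κK μN hK θ Φ₂ hΦ₂ g' hg' hgc' v x

end Literature.NumberTheory.Rogawski1990

end
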